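import Summits.QuantumFields.YangMills.Theorems.UnitScaleTiltHalvingP1FlatCoreTopSizesOfTopRowsGamma
import Summits.QuantumFields.YangMills.Theorems.UnitScaleTiltHalvingP1FlatCoreSupplierRestr129
import Summits.QuantumFields.YangMills.Theorems.UnitScaleTiltHalvingP1FlatCoreSupplierLandau
import Summits.QuantumFields.YangMills.Theorems.UnitScaleTiltHalvingP1FlatCoreSupplierInduction
import Literature.MathematicalPhysics.QuantumFieldTheory.Balaban1983to89.B8SockHFPCubeMember
import Literature.MathematicalPhysics.QuantumFieldTheory.Balaban1983to89.B8Prop6OfThm4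
import Literature.MathematicalPhysics.QuantumFieldTheory.Balaban1983to89.B8LeafKnitZd3CubBdryBeta
import Literature.MathematicalPhysics.QuantumFieldTheory.Balaban1983to89.B8CubeMemberLamBPrimeLaws
import HarnessLib

/-!
# Line H (`BirthV10.stub_halvingStep`, stmt-QuantumFields-19200) — ROAD γ (LEAD-H WORD 21 (γ-1)), T4γ:
# ★★★ THE TWO (1.36) SIZE ROWS OF ONE SITE FROM THE TOP-STEP ROWS, THE (1.59) IN-EDGE IN EDITION γ AT N05's CUBE MEMBER WITH PRINT's SPLIT CLASS `Λb := cubeLamBP'`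

Cell `ym3-torus` (HUMAN RULING D-0037: YM₃ on T³ is ladder rung R3 — NOT d = 4, NOT a mass gap, NOT the Clay problem).  Twin of ✓p654113 `siteSizeRows_of_topRows` at the cube
member of (1.131) (`Ω := cubeFam false L a M′ ρ′ (m+1)`, `Λs := cubeLamS …`) with the averaging class OF RECORD `Λb := cubeLamBP' L a M′ ρ′ (m+1)` (print's class, [B6] (2.3):
inner bonds at every level and the level-`j ≥ 1` CROSSING bonds; lit ✓`B9SupplySockB9P3ZdGamma.cubeLamBP'` :527) whose box law «box ⊂ Ω_{j−1}» is the lit THEOREM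
✓`B8CubeMemberLamBPrimeLaws.cubeLamBP'_hbox_pred` (`1 ≤ L ≤ ρ′`), and ✓`hX_of_topRows_γ` (T3γ) in place of ✓p647823: the five [3]-window rows `hα3 hα4 hsmallP hc₃P hC₂` are
the γ ones (at `L²α₀`, `L·α₂`, `C₂·L²`) — the (1.29)-inversion ✓`restr129_product_of_topRows` keeps reading the UNshifted `C0·α₀ ≤ ⅓`, `4α₀ ≤ c2′`, derived inside from the γ rows
(`α₀ ≤ L²α₀`); the in-edge `H59 ↦ H59γ` with lit's exterior-data rows `{Bbd aβ} hBbd haβ0 haβ hbdry haβα h66` threaded and the boundary-layer law DISCHARGED by lit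
✓`B8LeafKnitZd3CubBdryBeta.bdryLayer_cubeMember`; the datum's support clause `hu₁S`; everything else (J3's rows, the JOIN windows, `H42`, the top-step rows, `hknit`, the
conclusion `hX1 hX2` with any `Bε ≥ c⋆`) LETTER FOR LETTER as ✓p654113.  Bytes: ★ym-ust-20520-w3 g8's banked β draft `…HSiteSizeRowsOfTopRowsBdryBeta`, γ re-lettering
ym-ust-19936-w2 g9.  `--supports stmt-QuantumFields-19200 --as helper`; THEOREMS ONLY (0 `def`, 0 `sorry`); count-neutral.

HONEST SCOPE ∕ A6.  By-name composition; `H42`, `H59γ`, `hknit` and the windows stay displayed.  At this member and class the displayed `H59γ` text is A6-witnessed at truncation 0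
(lit ✓`sockB9P3D4γ_at_nonvacuous_cubeLamBP'_zero` :729) and is print's (1.59) = [4] Thm 3.3 at print's class (PROVED at `U₀ = 1`: ✓`sc4_cubeMember_of_ineq159Printed` ∘
✓`ineq159FlatCubeMemberPrinted_holds_L3`; OPEN for general `U₀`); the three earlier editions (plain, D4, β@`cubeLamB`) are kernel-refuted at this member and are NOT used.
Nothing of Prop. 3∕5, Theorem 4, [4], `core′`, the stub or the crux is proved; the YM gap is NOT proved.

References: T. Bałaban, CMP **99** (1985) 75–102 [Balaban1985RegularSpaces] (Prop. 3 (1.36)–(1.42) pp.82–83, (1.29) p.81, (1.31) p.82, (1.59) p.86, (1.66)–(1.69) p.88,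
(1.108) p.94, (1.131) p.99); CMP **99** (1985) 389–434 [Balaban1985BackgroundPropagators] (Thm 3.3 p.399); CMP **96** (1984) 223–250 [Balaban1984PropagatorsII] ((2.3) p.224).
-/

set_option autoImplicit false

noncomputable section

open scoped BigOperators
open NormedSpace
open Complex (I)

namespace Summit.QuantumFields.YangMills.Theorems.HalvingHSiteSizeRowsOfTopRowsGamma

open Literature.MathematicalPhysics.QuantumFieldTheory.Balaban1983to89
open MatrixLog (mlog)
open B7Prop1Explicit (e expUnit)
open B7Prop1Explicit renaming Site → LSite
open B7Prop2Explicit (unitaryUnits C0 c2' avgIter)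
open B7Prop3Flat (c3)
open B7Prop10General (C6 C4G)
open B7Prop9Flat (C5')
open B7Prop1Local (InBox loK bondHiK)
open B7Eq78Linearization (conjR)
open B7Eq92Concrete (mgauge mgauge_apply)
open B8Ineq130 (tlo thi)
open B8Ineq132 (covDerivFwd InAk BondTouches)
open B8Eq119TwistedAxial (Restr129 InAx)
open B8Eq131Cubes (cube)
open B8Eq131CubesAdmissible (cubeFam cubeFam_false_of_le)
open B8CubeMemberZd (cubeLamS hΩ_cubeFam)
open B8SockHFPCubeMember (htw_cubeLamS h8lt_cubeLamS h8top_cubeLamS)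
open B8Lemma1NonAbelian (mulCfg)
open B8Eq184Proof (gaugeExp cfgExp)
open B8Eq182Proof (gAd)
open B8Eq188Proof (frakF3)
open B8Eq140Level (SideTouches sideTouches_of_bondTouches)
open B8Eq146AExpansion (iEta)
open B8Eq138LandauZd (IsLandau138W covDivB covLap QT logCfg isLandau138W_congr)
open B7Prop4GeneralLevels (logCovIter linCovIter)
open B8Eq155JBound (Jcur wsup)
open B8ScaledSupNorm (bondNorm msup)
open B8LambdaSpaceKLevel (wt)
open B8Eq178Averages (Qnl)
open B8Prop6OfThm4 (one_inAk)
open HalvingP1FlatCoreTopSizesGamma (hX_of_topRows_γ)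
open B9SupplySockB9P3ZdBeta (CrossB)
open B9SupplySockB9P3ZdGamma (cubeLamBP')
open B8CubeMemberLamBPrimeLaws (cubeLamBP'_hbox_pred)
open B8LeafKnitZd3CubBdryBeta (bdryLayer_cubeMember)
open HalvingP1FlatCoreSupplierRestr129 (restr129_product_of_topRows)
open HalvingP1FlatCoreSupplierLandau (landau_and_near_of_topStepOutput)
open HalvingP1FlatCoreSupplierInduction (h34_of_inAk_univ hAx_of_inAx_one)

variable {d : ℕ} {𝔸 : Type*} [CStarAlgebra 𝔸] [Nontrivial 𝔸]

/-- ★★★ **THE TWO (1.36) SIZE ROWS OF ONE SITE FROM THE TOP-STEP ROWS, THE (1.59) IN-EDGE IN EDITION γ** — see the module docstring: ✓`hX_of_topRows_γ` at N05's cube member of record with its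
`h129` guard discharged (✓p650567), its Landau guard from the top-step output (✓p645467 + lit ✓`isLandau138W_congr`), the boundary-layer law by lit ✓`bdryLayer_cubeMember`, the top-knit
clause `Q` abstract (`hknit`), output weakened to any `Bε ≥ c⋆` — rows `hX1 hX2` of ✓p647313 `hSupBlock_of_topRows`. [cite: Balaban1985RegularSpaces, Prop. 3 (1.36)-(1.42) pp.82-83, (1.29) p.81, (1.31) p.82, (1.59) p.86, (1.66)-(1.69) p.88, (1.108) p.94, (1.131) p.99; Balaban1985BackgroundPropagators, Thm 3.3 p.399, (3.16) p.393; Balaban1985Averaging, Prop. 10 (203)-(207) p.50] -/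
theorem siteSizeRows_of_topRows_γ (hd2 : 2 ≤ d) {η : ℝ} (hη : 0 < η) {L : ℕ} (hL : 2 ≤ L)
    -- N05's cube member OF RECORD (defining equations; callers write `rfl`), level `k = m + 1`
    {a : LSite d} {M' ρ' : ℕ} (hρ' : L ≤ ρ') {m : ℕ}
    {Ω : ℕ → Set (LSite d)} (hΩdef : Ω = cubeFam false L a M' ρ' (m + 1))
    {Λs : ℕ → ℕ → Set (LSite d)} (hΛsdef : Λs = cubeLamS L a M' ρ' (m + 1))
    {Λb : ℕ → ℕ → Set (LSite d × Fin d)} (hΛbdef : Λb = cubeLamBP' L a M' ρ' (m + 1))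
    -- the pre-gauged field: unitary, J3's (1.34)-𝔄 on `ℤᵈ` and axial rows (✓p647600 §1's currency)
    {U' : LSite d → Fin d → 𝔸ˣ} (hU' : ∀ x κ, U' x κ ∈ unitaryUnits 𝔸)
    {α₀ α₁ α₄ B₀ cstar : ℝ} (hα₀ : 0 < α₀) (hα₁ : 0 < α₁) (hα₄ : 0 < α₄) (hB₀ : 0 < B₀)
    (hc : cstar = 5 * d * L * B₀ * (α₀ + α₁))
    (hInAk : InAk L (m + 1) η α₀ (fun _ => (Set.univ : Set (LSite d))) U')
    (hAxJ : ∀ m', m' ≤ m + 1 → ∀ Λ : ℕ → Set (LSite d), InAx L m' Λ (1 : LSite d → Fin d → 𝔸ˣ) U')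
    -- Prop. 3's windows at `(α₀, α₂ := 2(L·c⋆) + 8α₄)` (✓p647823's, VERBATIM)
    (hα3 : C0 d * ((L : ℝ) ^ 2 * α₀) ≤ 1 / 3) (hα4 : 4 * ((L : ℝ) ^ 2 * α₀) ≤ c2' d L)
    (h16 : 16 * (2 * (L * cstar) + 8 * α₄) ≤ 1) (hd5 : 5 * (2 * (L * cstar) + 8 * α₄) * ((d : ℝ) - 1) ≤ 4)
    (hsmallP : Real.exp (4 * (800 * ((d : ℝ) + 1) ^ 2 * ((d : ℝ) + 4)) * ((L : ℝ) ^ 2 * α₀))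
      * (1 + 8 * (131072 * ((d : ℝ) + 1) ^ 2) * ((L : ℝ) * (2 * (L * cstar) + 8 * α₄))) ≤ 2)
    (hc₃P : 2 * ((L : ℝ) * (2 * (L * cstar) + 8 * α₄)) ≤ c3 d L) (hside : 36 * d * B₀ * (2 * (L * cstar) + 8 * α₄) ≤ 1 / 2)
    (h50 : 50 * d * (2 * (L * cstar) + 8 * α₄) ≤ 1)
    {C₂ : ℝ} (hC₂ : 8 * (131072 * ((d : ℝ) + 1) ^ 2) * Real.exp (4 * (800 * ((d : ℝ) + 1) ^ 2 * ((d : ℝ) + 4)) * ((L : ℝ) ^ 2 * α₀))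
      * (L : ℝ) ^ 2 ≤ C₂)
    (h61 : 2 * (2 * (L * cstar) + 8 * α₄) ^ 2 + 20 * d * α₀ * (2 * (L * cstar) + 8 * α₄)
      + 2 * C₂ * (2 * (L * cstar) + 8 * α₄) ^ 2 ≤ α₀ + α₁)
    -- edition β (lit's bookkeeping of exterior data at the finite `□₀`): the collar constant `B_∂`, the (1.66)₀ level `aβ`, the absorption window, and (1.66)₀ on the sides touching `□₀`
    {Bbd aβ : ℝ} (hBbd : 0 ≤ Bbd) (haβ0 : 0 ≤ aβ) (haβ : aβ ≤ 1 / 4) (hbdry : 4 * Bbd * aβ ≤ ((d : ℝ) * L - 1) * B₀ * (α₀ + α₁))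
    (haβα : aβ ≤ (d : ℝ) * L * α₁)
    (h66 : ∀ b ∈ {b : LSite d × Fin d | SideTouches (Ω 0) b.1 b.2}, ‖((U' b.1 b.2 : 𝔸ˣ) : 𝔸) - 1‖ ≤ aβ)
    -- the JOIN's windows (✓p646092's, the subset the (1.29)-inversion ✓p650567 reads)
    {cB : ℝ} (hcBlo : L * cstar ≤ cB)
    (hsmall : Real.exp (4 * (800 * ((d : ℝ) + 1) ^ 2 * ((d : ℝ) + 4)) * α₀) * (1 + 8 * (131072 * ((d : ℝ) + 1) ^ 2) * cB) ≤ 2)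
    (hc₃ : 2 * cB ≤ c3 d L) (hsc : 2048 * (d : ℝ) * cB ≤ 1) (hα₃' : 40 * d * cB ≤ 1 / 200)
    (hs₁ : 200 * C6 d * (2 * α₄) ≤ 1) (hs₂ : 12000 * ((d : ℝ) + 1) * L * (2 * α₄) ≤ 1)
    (hs₃ : C4G d L * (α₀ + 40 * d * cB + 4 * (2 * α₄)) ≤ 1)
    (hs₄ : 1024 * ((d : ℝ) + 1) * ((d : ℝ) + 4) * L ^ 2 * α₀ ≤ 1) (hs₅ : 32 * ((d : ℝ) + 1) ^ 2 * C6 d * L ^ 2 * α₀ ≤ 1)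
    (hs₆ : 16 * d * C5' d * C6 d * (L : ℝ) ^ 2 * α₀ ≤ 1)
    (hprod8 : 2 * C6 d * (40 * d * cB + 4 * α₄) ≤ 1 / 8)
    -- the two Prop-3 sockets of ✓p644380 READ AT `Lan k V := IsLandau138W … V ∧ Q V`, top family emptied in the (1.29) guard (N05∕N06; `H42` ⟸ ✓p645668 at the torus knit `Q`)
    (Q : (LSite d → Fin d → 𝔸ˣ) → Prop)
    (H42 : ∀ (u : LSite d → 𝔸ˣ) (V : LSite d → Fin d → 𝔸ˣ) (A' : LSite d → Fin d → 𝔸),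
      (∀ x, u x ∈ unitaryUnits 𝔸) → mgauge (1 : LSite d → Fin d → 𝔸ˣ) u V = U' →
      Restr129 L (m + 1) (Function.update (Λs (m + 1)) (m + 1) ∅) (1 : LSite d → Fin d → 𝔸ˣ) u →
      (IsLandau138W L (m + 1) η (Ω 0) (Λs (m + 1)) (1 : LSite d → Fin d → 𝔸ˣ) V ∧ Q V) →
      (∀ y τ, IsSelfAdjoint (A' y τ)) →
      (∀ j, j ≤ m + 1 → ∀ y τ, SideTouches (Ω j) y τ →
        V y τ = cfgExp η A' y τ ∧ ‖A' y τ‖ ≤ (2 * (L * cstar) + 8 * α₄) * ((L : ℝ) ^ j * η)⁻¹) →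
      (∀ y τ, (∀ j, j ≤ m + 1 → ¬ SideTouches (Ω j) y τ) → A' y τ = 0) →
      ∀ j, j ≤ m + 1 → ∀ c ∈ Λb (m + 1) j, ‖logCovIter L (1 : LSite d → Fin d → 𝔸ˣ) (iEta η A') j c.1 c.2‖ < 2 * d * L * α₁)
    (H59γ : ∀ (u : LSite d → 𝔸ˣ) (V : LSite d → Fin d → 𝔸ˣ) (A' : LSite d → Fin d → 𝔸),
      (∀ x, u x ∈ unitaryUnits 𝔸) → (∀ x, x ∉ Ω 0 → u x = 1) → mgauge (1 : LSite d → Fin d → 𝔸ˣ) u V = U' →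
      Restr129 L (m + 1) (Function.update (Λs (m + 1)) (m + 1) ∅) (1 : LSite d → Fin d → 𝔸ˣ) u →
      (IsLandau138W L (m + 1) η (Ω 0) (Λs (m + 1)) (1 : LSite d → Fin d → 𝔸ˣ) V ∧ Q V) →
      (∀ y τ, IsSelfAdjoint (A' y τ)) →
      (∀ j, j ≤ m + 1 → ∀ y τ, SideTouches (Ω j) y τ →
        V y τ = cfgExp η A' y τ ∧ ‖A' y τ‖ ≤ (2 * (L * cstar) + 8 * α₄) * ((L : ℝ) ^ j * η)⁻¹) →
      (∀ y τ, (∀ j, j ≤ m + 1 → ¬ SideTouches (Ω j) y τ) → A' y τ = 0) →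
      msup L (m + 1) η (-(1 : ℝ)) (fun j (b : LSite d × Fin d) => SideTouches (Ω j) b.1 b.2) (fun b => A' b.1 b.2)
          ≤ B₀ * (bondNorm L (m + 1) η (-(3 : ℝ)) Ω (fun x μ => Jcur η (1 : LSite d → Fin d → 𝔸ˣ) A' μ x)
            + wsup 1 (fun p : {p : ℕ × (LSite d × Fin d) // p.1 ≤ m + 1 ∧ (p.2 ∈ Λb (m + 1) p.1 ∨ (p.1 = 0 ∧ CrossB (Ω 0) p.2))} =>
                linCovIter L (1 : LSite d → Fin d → 𝔸ˣ) (iEta η A') p.1.1 p.1.2.1 p.1.2.2))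
            + Bbd * msup L (m + 1) η (-(1 : ℝ)) (fun j (b : LSite d × Fin d) => j = 0 ∧ SideTouches (Ω 0) b.1 b.2 ∧ ¬ BondTouches (Ω 0) b.1 b.2)
                (fun b => A' b.1 b.2) ∧
        msup L (m + 1) η (-(2 : ℝ)) (fun j (t : Fin d × Fin d × LSite d) => SideTouches (Ω j) t.2.2 t.2.1)
            (fun t => covDerivFwd η (1 : LSite d → Fin d → 𝔸ˣ) t.1 (fun z => A' z t.2.1) t.2.2)
          ≤ B₀ * (bondNorm L (m + 1) η (-(3 : ℝ)) Ω (fun x μ => Jcur η (1 : LSite d → Fin d → 𝔸ˣ) A' μ x)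
            + wsup 1 (fun p : {p : ℕ × (LSite d × Fin d) // p.1 ≤ m + 1 ∧ (p.2 ∈ Λb (m + 1) p.1 ∨ (p.1 = 0 ∧ CrossB (Ω 0) p.2))} =>
                linCovIter L (1 : LSite d → Fin d → 𝔸ˣ) (iEta η A') p.1.1 p.1.2.1 p.1.2.2))
            + Bbd * msup L (m + 1) η (-(1 : ℝ)) (fun j (b : LSite d × Fin d) => j = 0 ∧ SideTouches (Ω 0) b.1 b.2 ∧ ¬ BondTouches (Ω 0) b.1 b.2)
                (fun b => A' b.1 b.2))
    -- Theorem 4's datum at level `m` (N05's letters, as ✓p647600 emits them) WITH ITS SUPPORT CLAUSE (lit's β drivers; (V7-4))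
    {u₁ : LSite d → 𝔸ˣ} {W : LSite d → Fin d → 𝔸ˣ} {A : LSite d → Fin d → 𝔸}
    (hu₁ : ∀ x, u₁ x ∈ unitaryUnits 𝔸) (hu₁S : ∀ x, x ∉ Ω 0 → u₁ x = 1) (hWd : mgauge (1 : LSite d → Fin d → 𝔸ˣ) u₁ W = U')
    (h129 : Restr129 L m (Λs m) (1 : LSite d → Fin d → 𝔸ˣ) u₁)
    (hdat : ∀ j, j ≤ m → ∀ b ∈ {b : LSite d × Fin d | SideTouches (Ω j) b.1 b.2},
      W b.1 b.2 = cfgExp η A b.1 b.2 ∧ IsSelfAdjoint (A b.1 b.2) ∧ ‖A b.1 b.2‖ ≤ cstar * ((L : ℝ) ^ j * η)⁻¹)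
    -- the top step's `λ′` with its OUTPUT rows (✓p646092∕✓p648920's conjuncts `hsa hsupp h108 hmult (lo) hA0`) and their two windows
    {lam : LSite d → 𝔸} {cA : ℝ} (hα70 : α₄ ≤ 1 / 70) (hcA0 : 0 ≤ cA) (hcA : cA ≤ 1 / 12)
    (hsa : ∀ x, IsSelfAdjoint (lam x)) (hsupp : ∀ x, x ∉ Ω 0 → lam x = 0)
    (h108 : ∀ j, j ≤ m + 1 → ∀ b ∈ {b : LSite d × Fin d | SideTouches (Ω j) b.1 b.2},
      ‖lam b.1‖ ≤ α₄ ∧ wt L η j * ‖covDerivFwd η (1 : LSite d → Fin d → 𝔸ˣ) b.2 lam b.1‖ ≤ α₄)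
    (hmult : ∃ μ : ℕ → LSite d → 𝔸, ∀ x ∈ Ω 0,
      covLap η (1 : LSite d → Fin d → 𝔸ˣ) ((Ω 0).indicator fun y =>
        covDivB η (1 : LSite d → Fin d → 𝔸ˣ) A y + covLap η (1 : LSite d → Fin d → 𝔸ˣ) lam y +
        ((conjR (gaugeExp lam y)⁻¹ (covDivB η (1 : LSite d → Fin d → 𝔸ˣ) A y) - covDivB η (1 : LSite d → Fin d → 𝔸ˣ) A y) +
          (gAd (covLap η (1 : LSite d → Fin d → 𝔸ˣ) lam y) (lam y) - covLap η (1 : LSite d → Fin d → 𝔸ˣ) lam y) +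
          ∑ μ, frakF3 η (1 : LSite d → Fin d → 𝔸ˣ) lam A y μ)) x = QT L (m + 1) (Λs (m + 1)) (1 : LSite d → Fin d → 𝔸ˣ) μ x)
    (hlo : ∀ j, j < m + 1 → ∀ y ∈ Λs (m + 1) j, Qnl L (1 : LSite d → Fin d → 𝔸ˣ) (expUnit ∘ ((-I) • lam)) u₁⁻¹ j y = 0)
    (hA0 : ∀ x ∈ Ω 0, ∀ μ : Fin d,
      wt L η 0 * ‖A x μ‖ ≤ cA ∧ wt L η 0 * ‖conjR ((1 : LSite d → Fin d → 𝔸ˣ) (x - e μ) μ)⁻¹ (A (x - e μ) μ)‖ ≤ cA)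
    -- the top-knit clause for the gauge-fixed datum field (displayed; torus: ✓p645686 at the gauge `u₁·e^{iλ′}`)
    (hknit : Q (mgauge (1 : LSite d → Fin d → 𝔸ˣ) (gaugeExp lam)⁻¹ W))
    -- the output constant, and `η⁻¹ = L^{m+1}` (the composer's `η := L^{−(m+1)}`)
    {Bε : ℝ} (hcsB : cstar ≤ Bε) (hηL : η⁻¹ = (L : ℝ) ^ (m + 1)) :
    (∀ j, j ≤ m + 1 → ∀ z ∈ cube L a M' ρ' (m + 1) j, ∀ ν' : Fin d,
      (L : ℝ) ^ j * η * ‖logCfg η (mgauge (1 : LSite d → Fin d → 𝔸ˣ) (gaugeExp lam)⁻¹ (cfgExp η A)) z ν'‖ ≤ Bε) ∧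
    (∀ j, j ≤ m + 1 → ∀ z ∈ cube L a M' ρ' (m + 1) j, ∀ ν' μ' : Fin d, z + e μ' ∈ cube L a M' ρ' (m + 1) 0 →
      ((L : ℝ) ^ j * η) ^ 2 * (L : ℝ) ^ (m + 1) *
        ‖logCfg η (mgauge (1 : LSite d → Fin d → 𝔸ˣ) (gaugeExp lam)⁻¹ (cfgExp η A)) (z + e μ') ν' -
          logCfg η (mgauge (1 : LSite d → Fin d → 𝔸ˣ) (gaugeExp lam)⁻¹ (cfgExp η A)) z ν'‖ ≤ Bε) := by
  subst hΩdef hΛsdef hΛbdef hc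
  have hL1 : 1 ≤ L := le_trans (by norm_num) hL
  have hLr : (1 : ℝ) ≤ L := by exact_mod_cast hL1
  have hcs0 : 0 ≤ 5 * (d : ℝ) * L * B₀ * (α₀ + α₁) := by positivity
  -- the member geometry BY NAME
  have hΩ := hΩ_cubeFam (d := d) hL1 a M' hρ' (m + 1)
  have hbox := cubeLamBP'_hbox_pred (d := d) hL1 a M' hρ' (m + 1)
  -- [3]-Prop-4 windows at `α₀` from the γ windows at `L²α₀` (`L ≥ 1`), for the (1.29)-inversion
  have hL2α : α₀ ≤ (L : ℝ) ^ 2 * α₀ := le_mul_of_one_le_left hα₀.le (one_le_pow₀ hLr)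
  have hα3₀ : C0 d * α₀ ≤ 1 / 3 := (mul_le_mul_of_nonneg_left hL2α (B7Prop2Explicit.C0_pos d).le).trans hα3
  have hα4₀ : 4 * α₀ ≤ c2' d L := by linarith
  have htower := htw_cubeLamS (d := d) hL1 a M' ρ' (m + 1) (m + 1) le_rfl
  have hlt := h8lt_cubeLamS (d := d) L a M' ρ' (m + 1) m (lt_add_one m)
  have htop := h8top_cubeLamS (d := d) hL1 a M' ρ' (m + 1) m (lt_add_one m)
  -- the pre-gauged field's rows at the flat background
  have h33 : InAk L (m + 1) η α₀ (cubeFam false L a M' ρ' (m + 1)) (1 : LSite d → Fin d → 𝔸ˣ) := one_inAk hL1 (m + 1) hη hα₀ _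
  have h34 := h34_of_inAk_univ hInAk (cubeFam false L a M' ρ' (m + 1))
  have hAx := hAx_of_inAx_one hAxJ (cubeLamS L a M' ρ' (m + 1))
  -- the (1.29) guard of the composite gauge below the top (✓p650567)
  have h129c := restr129_product_of_topRows hd2 hL hη hΩ (lt_add_one m) htower hlt htop hα₀ hα₁ hB₀ hα₄ rfl h33 h34 hAx hu₁ hWd h129 hdat
    hcBlo hα3₀ hα4₀ hsmall hc₃ hsc hα₃' hs₁ hs₂ hs₃ hs₄ hs₅ hs₆ hprod8 h108 hlo
  -- the Landau guard: (1.38) of `e^{iηA}` gauge-fixed (✓p645467), transported to the datum field (they agree on the bonds touching `□₀`)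
  have hLanE := (landau_and_near_of_topStepOutput hd2 hη L (m + 1) (cubeFam false L a M' ρ' (m + 1) 0) (cubeLamS L a M' ρ' (m + 1) (m + 1))
    hα₄.le hα70 hcA0 hcA hsupp (h108 0 (Nat.zero_le _)) hA0 hmult).1
  haveI : Nontrivial (Fin d) := Fin.nontrivial_iff_two_le.mpr hd2
  have hagree : ∀ (x : LSite d) (μ : Fin d), BondTouches (cubeFam false L a M' ρ' (m + 1) 0) x μ →
      mgauge (1 : LSite d → Fin d → 𝔸ˣ) (gaugeExp lam)⁻¹ W x μ = mgauge (1 : LSite d → Fin d → 𝔸ˣ) (gaugeExp lam)⁻¹ (cfgExp η A) x μ := by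
    intro x μ hb
    obtain ⟨κ, hκ⟩ := exists_ne μ
    have hs : SideTouches (cubeFam false L a M' ρ' (m + 1) 0) x μ := sideTouches_of_bondTouches hκ hb
    rw [mgauge_apply, mgauge_apply, (hdat 0 (Nat.zero_le _) (x, μ) hs).1]
  have hLanW : IsLandau138W L (m + 1) η (cubeFam false L a M' ρ' (m + 1) 0) (cubeLamS L a M' ρ' (m + 1) (m + 1)) (1 : LSite d → Fin d → 𝔸ˣ)
      (mgauge (1 : LSite d → Fin d → 𝔸ˣ) (gaugeExp lam)⁻¹ W) := (isLandau138W_congr η L _ hagree).2 hLanE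
  -- the level cubes inside the member's domains (by definition)
  have hΩcube : ∀ j, j ≤ m + 1 → cube L a M' ρ' (m + 1) j ⊆ cubeFam false L a M' ρ' (m + 1) j := fun j hj => by
    rw [cubeFam_false_of_le L a M' ρ' hj]
  -- the boundary-layer law at the member (lit ✓`bdryLayer_cubeMember`), read at the emptied-top family (level `0 ≠ m + 1` untouched)
  have hlay : ∀ y z : LSite d, y ∈ cubeFam false L a M' ρ' (m + 1) 0 → z ∉ cubeFam false L a M' ρ' (m + 1) 0 →
      (∀ i, y i - 1 ≤ z i ∧ z i ≤ y i + 1) → y ∈ (Function.update (cubeLamS L a M' ρ' (m + 1) (m + 1)) (m + 1) ∅) 0 := by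
    intro y z hy hz hyz
    rw [Function.update_of_ne (by omega : (0 : ℕ) ≠ m + 1)]
    exact bdryLayer_cubeMember hL a M' ρ' (m + 1) hρ' (by omega) (m + 1) (by omega) le_rfl y z hy hz hyz
  -- ✓`hX_of_topRows_γ` BY NAME at `Lan k V := IsLandau138W … V ∧ Q V`, `Λs′ k := Function.update (Λs k) k ∅`
  obtain ⟨hX1, hX2⟩ := hX_of_topRows_γ hd2 hη hL (Nat.succ_le_succ (Nat.zero_le m)) hU' hα₀ hα₁.le hα₄.le hB₀.le rfl hα3 hα4 h16 hd5 hsmallP hc₃P hside h50 hC₂ h61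
    hBbd haβ0 haβ hbdry haβα
    (cubeFam false L a M' ρ' (m + 1)) hΩ (fun _ => Function.update (cubeLamS L a M' ρ' (m + 1) (m + 1)) (m + 1) ∅) (cubeLamBP' L a M' ρ' (m + 1))
    (hbox (m + 1) le_rfl) h33 h34 h66 hlay
    (fun k V => IsLandau138W L k η (cubeFam false L a M' ρ' (m + 1) 0) (cubeLamS L a M' ρ' (m + 1) k) (1 : LSite d → Fin d → 𝔸ˣ) V ∧ Q V)
    H42 H59γ u₁ W A hu₁ hu₁S hWd (fun j hj y τ hs => hdat j (by omega) (y, τ) hs) lam hsa hsupp (fun j hj y τ hs => h108 j hj (y, τ) hs) h129c ⟨hLanW, hknit⟩ hΩcube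
  refine ⟨fun j hj z hz ν' => (hX1 j hj z hz ν').trans hcsB, fun j hj z hz ν' μ' hz' => ?_⟩
  rw [← hηL]
  exact (hX2 j hj z hz ν' μ' hz').trans hcsB

end Summit.QuantumFields.YangMills.Theorems.HalvingHSiteSizeRowsOfTopRowsGamma

end
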